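import Literature.Analysis.FluidPDE.AlbrittonFarFieldCalderon
import HarnessLib

/-!
# Albritton 2018, Cor. 4.6 over Albritton's class — the corrected named statement, proved

Analysis/FluidPDE file vendoring the **corrected rendering** of the tree's named fact
`Literature.Analysis.FluidPDE.albritton_singular_point_of_blowup` (`AlbrittonBlowupCriterion.lean`)
together with its proof. The tree fact quantifies over `IsMaximalBesovMildSolution` (maximal
solutions in the bare duality-form/Besov class `IsBesovMildSolutionOn`: weakly divergence-free
slices, the duality identity against solenoidal tests, `C_tḂ`, Kato's `K̊_∞`), whereas Albritton's
Cor. 4.6 ("Let `u` be the mild solution of Theorem 4.2 with initial data `u₀`. If `T*(u₀) < ∞`,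
then `u` has a singular point at time `T*(u₀)`") is about the member of the class (4.52) of
Thm. 4.2 — `C([0,T); Ḃ^{s_p}_{p,q}) ∩ K̊_p ∩ K̊_∞` with the integral equation — rendered in the
tree as `IsKatoBesovMildSolutionOn` / `IsMaximalKatoBesovMildSolution`
(`AlbrittonBlowupCriterionKato.lean`). The identification of the two maximal notions is not
printed in the source (module docstring of `AlbrittonSingularPointKatoClass.lean`), so the tree
fact is recorded as mis-stated and the faithful statement is vendored here under a new name, with
the same cite, and PROVED (`AlbrittonFarFieldCalderon.katoClass_singular_point`: Albritton's
proof of Prop. 4.5 — Calderón splitting, energy class of the remainder, ε-regularity far field —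
and the `L^∞` continuation inside the class, `albritton_continuation_katoClass`).

## References

* D. Albritton, *Blow-up criteria for the Navier–Stokes equations in non-endpoint critical Besov
  spaces*, Anal. PDE 11 (2018) 1415–1456 = arXiv:1612.04439, Cor. 4.6, Prop. 4.5, Thm. 4.2.
  [Albritton2018]
-/

noncomputable section

open MeasureTheory TemperedDistribution TopologicalSpace Set Function Filter Metric
open _root_.Topology
open scoped SchwartzMap ENNReal NNReal RealInnerProductSpace

namespace Literature.Analysis.FluidPDE

/-- **Albritton 2018, Cor. 4.6 — corrected rendering over Albritton's class.** The tree's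
`albritton_singular_point_of_blowup` (`AlbrittonBlowupCriterion.lean`) quantifies over
`IsMaximalBesovMildSolution` — maximal solutions in the bare duality-form/Besov class
`IsBesovMildSolutionOn` — whereas the source's Cor. 4.6 is about "the mild solution of
Theorem 4.2", i.e. the member of the class (4.52) of Thm. 4.2: `C([0,T); Ḃ^{s_p}_{p,q}) ∩ K̊_p ∩
K̊_∞` with the integral equation, here `IsKatoBesovMildSolutionOn` /
`IsMaximalKatoBesovMildSolution` (`AlbrittonBlowupCriterionKato.lean`); the identification of the
two classes is not printed in the source (see the module docstring of
`AlbrittonSingularPointKatoClass.lean`). This is the statement of Cor. 4.6 for Albritton's class: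
for `0 < ν`, `3 < p, q < ∞`, `0 < T`, a maximal member `(u, U)` of the class on `[0, T)` has a
singular point at time `T` — some `x₀` with `u ∉ L^∞(Q_r(T, x₀))` for every `0 < r`, `r² < T`.
Same cite as the tree fact. [cite: Albritton2018, Cor. 4.6 (with Prop. 4.5, Thm. 4.2 (i))] -/
def albritton_singular_point_of_blowup_katoClass : Prop :=
  ∀ ⦃ν : ℝ⦄ (_ : 0 < ν) ⦃p q : ℝ≥0∞⦄ [Fact (1 ≤ p)] (_ : 3 < p) (_ : p < ⊤) (_ : 3 < q) (_ : q < ⊤)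
    ⦃T : ℝ⦄ (_ : 0 < T) ⦃u : ℝ → (EuclideanSpace ℝ (Fin 3)) → (EuclideanSpace ℝ (Fin 3))⦄
    ⦃U : ℝ → 𝓢'((EuclideanSpace ℝ (Fin 3)), (EuclideanSpace ℂ (Fin 3)))⦄
    (_ : IsMaximalKatoBesovMildSolution p q T ν u U),
    ∃ x₀ : (EuclideanSpace ℝ (Fin 3)), ∀ r : ℝ, 0 < r → r ^ 2 < T →
      eLpNorm (uncurry u) ⊤ (volume.restrict (parabolicCylinder r ((T : ℝ), x₀))) = ⊤

/-- **Albritton 2018, Cor. 4.6 over Albritton's class, proved** (`katoClass_singular_point`).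
[cite: Albritton2018, Cor. 4.6 (with Prop. 4.5, Thm. 4.2 (i))] -/
theorem albritton_singular_point_of_blowup_katoClass_holds :
    albritton_singular_point_of_blowup_katoClass :=
  fun _ hν _ _ _ hp₃ hp hq₃ hq _ hT _ _ hmax =>
    AlbrittonFarFieldCalderon.katoClass_singular_point hν hp₃ hp hq₃ hq hT hmax

end Literature.Analysis.FluidPDE

end
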